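import Summits.CriticalPhenomena.CardyFormulaZ2.Theses.CardySelfRefinement
import Summits.CriticalPhenomena.CardyFormulaZ2.Theorems.CardySelfRefinementLagHandOffStopMeasurable
import Summits.CriticalPhenomena.CardyFormulaZ2.Theorems.CardySelfRefinementLagHandOffCommonPrefix
import Summits.CriticalPhenomena.CardyFormulaZ2.Theorems.CardySelfRefinementLagHandOffJointReadings
import Literature.Probability.Percolation.QuadCrossingSpaceZ2
import HarnessLib

/-!
# Locality passage: `IsLocal` and `IsTargetIndependent` of the hand-off family from exact lattice
identities — partial helper for stub `stub_freeAxioms` of line `crosscut-dictionary` for crux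
`LagHandOff` (stmt-CriticalPhenomena-10268)

The registered stub `stub_freeAxioms` (namespace
`Summit.CriticalPhenomena.CardyFormulaZ2.Cruxes.LagHandOff.CrosscutDictionary`) asks, for a Borel
reading `Ψ` with the joint hand-off property and `μ ∈ subseqQuadLimits univ`, that
`P D := (Ψ D)_* μ` be chordal (landed: `isChordal_of_handsOff`), LOCAL in LSW's restriction form
(`ChordalFamily.IsLocal`), TARGET INDEPENDENT (`ChordalFamily.IsTargetIndependent`) and a.s.
non-boundary-tracing.  This file reduces the two locality conjuncts to EXACT LATTICE STATEMENTS,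
with the entire limit passage proved:

* `ae_stopAt_eq_of_handsOff_pair` — if the interfaces of `(D₁, E₁)` and `(D₂, E₂)` hand off to
  `Ψ D₁`, `Ψ D₂` jointly with the same quad configuration along `δs → 0⁺`, `F` is closed, and
  (LATTICE HYPOTHESIS) for every `ρ > 0`, at all small meshes and for every configuration the two
  interfaces are equal or admit parametrisations agreeing on an initial parameter interval whose
  endpoint lands in `cthickening ρ F`, then `stopAt F (Ψ D₁ S) = stopAt F (Ψ D₂ S)` for `μ`-a.e.
  `S`.  Proof: the closed sets `closure {common ρ-prefix pairs} ∪ diagonal` are eventually sure,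
  hence almost sure for the pair of readings (`stub_freeAxioms_jointReadings` /
  `ae_mem_of_joint_of_isClosed`), and membership in all of them forces equal stopped curves
  (`stopAt_eq_of_commonPrefix`).  NO continuity of `stopAt` is used — it fails at one-sided
  touching (refuter's `Negative.StopAtDiscontinuity`); the lattice COUPLING is carried to the
  limit instead, as suggested there.
* `isLocal_of_handsOff`, `isTargetIndependent_of_handsOff` — the two conjuncts, given the
  lattice hypothesis for nested pairs `D' ⊆ D` with `F = closure (D ∖ D')`, resp. for
  `(D.chord 0 1, D.chord 0 2)` with `F = D.arc 1`; the events `stopAt F ⁻¹' T` are Borel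
  (`measurableSet_preimage_stopAt`, sibling helper of `stub_markovPassage`), so both sides are
  `μ`-measures of a.e.-equal sets.
* `stub_freeAxioms_localityPassage` — the registered sub-stub: `h1`, `h3` of `stub_freeAxioms`
  plus the two lattice hypotheses give `IsLocal P ∧ IsTargetIndependent P` for every `μ ∈ Λ`.

What remains DISCRETE (not here): compatible admissible `ℤ²`-discretisation families of nested /
re-targeted Dobrushin domains whose medial explorations coincide until they first read an edge
where the two boundary conditions differ (such edges lie within `O(δ)` of `F`), including the
exact reversal identity for the same carrier with swapped arcs; and the no-tracing conjunct
(boundary arm estimates).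

References: G. Lawler, O. Schramm, W. Werner, Acta Math. 187 (2001) §2, Cor. 2.3–2.4 (locality
and splitting: the processes coincide up to the exit time); S. Smirnov, C. R. Acad. Sci. 333 (2001)
§2 (the exploration process reads one edge at a time).
-/

noncomputable section

open MeasureTheory Filter Set Topology
open scoped BoundedContinuousFunction unitInterval ENNReal
open Literature.Probability.Percolation Literature.Probability.LatticeModels
open Literature.Probability.RandomPlanarGeometry Literature.Probability.Percolation.QuadCrossing
open Summit.CriticalPhenomena.CardyFormulaZ2.Theses.CardySelfRefinement

namespace Summit.CriticalPhenomena.CardyFormulaZ2.Cruxes.LagHandOff.CrosscutDictionary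

/-! ### The passage: exact lattice prefixes give equal stopped limits -/

/-- **Locality passes to the hand-off reading.** Let the interfaces of `(D₁, E₁)` and of
`(D₂, E₂)` hand off to `Ψ D₁`, `Ψ D₂` jointly with the SAME quad configuration along `δs → 0⁺`,
and let `F` be closed.  LATTICE HYPOTHESIS: for every `ρ > 0`, at all small meshes and for EVERY
configuration `ω`, the two interfaces are equal or have parametrisations agreeing on an initial
parameter interval whose endpoint is mapped into the closed `ρ`-neighbourhood of `F` (on `ℤ²`:
the two explorations coincide until they first read an edge where the two boundary conditions
differ, and such edges lie within `O(δ)` of `F`).  CONCLUSION: for `μ`-a.e. `S` the readings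
`Ψ D₁ S` and `Ψ D₂ S` have the same initial segment up to the first hitting of `F`.  Proof: the
closed sets `closure {common ρ-prefix pairs} ∪ diagonal` are eventually sure, hence a.s. in the
limit (`ae_mem_of_joint_of_isClosed`); conclude with `stopAt_eq_of_commonPrefix`. -/
theorem ae_stopAt_eq_of_handsOff_pair
    {Ψ : DobrushinDomain → QuadConfig (Set.univ : Set ℂ) → CurveClass ℂ}
    {μ : FiniteMeasure (QuadConfig (Set.univ : Set ℂ))} {δs : ℕ → ℝ}
    (hpos : ∀ n, 0 < δs n) (hlim : Tendsto δs atTop (𝓝 0))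
    {D₁ D₂ : DobrushinDomain} {E₁ E₂ : ℝ → DiscreteDobrushin}
    (hE₁ : ZdDiscretisationFamily D₁ E₁) (hE₂ : ZdDiscretisationFamily D₂ E₂)
    (hΨ₁ : Measurable (Ψ D₁)) (hΨ₂ : Measurable (Ψ D₂))
    (h3₁ : ∀ f : (QuadConfig (Set.univ : Set ℂ) × CurveClass ℂ) →ᵇ ℝ,
      Tendsto (fun n => ∫ ω, f (z2QuadConfig (Set.univ : Set ℂ) (δs n) ω,
          bondInterfaceIn D₁ (E₁ (δs n)) ω) ∂(bondPercolation (zdGraph 2) half))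
        atTop (𝓝 (∫ S, f (S, Ψ D₁ S) ∂(μ : Measure (QuadConfig (Set.univ : Set ℂ))))))
    (h3₂ : ∀ f : (QuadConfig (Set.univ : Set ℂ) × CurveClass ℂ) →ᵇ ℝ,
      Tendsto (fun n => ∫ ω, f (z2QuadConfig (Set.univ : Set ℂ) (δs n) ω,
          bondInterfaceIn D₂ (E₂ (δs n)) ω) ∂(bondPercolation (zdGraph 2) half))
        atTop (𝓝 (∫ S, f (S, Ψ D₂ S) ∂(μ : Measure (QuadConfig (Set.univ : Set ℂ))))))
    {F : Set ℂ} (hF : IsClosed F)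
    (hlat : ∀ ρ : ℝ, 0 < ρ → ∀ᶠ δ in 𝓝[>] (0 : ℝ), ∀ ω : BondConfig (Site 2),
      bondInterfaceIn D₁ (E₁ δ) ω = bondInterfaceIn D₂ (E₂ δ) ω ∨
      ∃ (c c' : Curve ℂ) (s : unitInterval), CurveClass.mk c = bondInterfaceIn D₁ (E₁ δ) ω ∧
        CurveClass.mk c' = bondInterfaceIn D₂ (E₂ δ) ω ∧ (∀ t : unitInterval, t ≤ s → c t = c' t) ∧
        c s ∈ Metric.cthickening ρ F) :
    ∀ᵐ S ∂(μ : Measure (QuadConfig (Set.univ : Set ℂ))),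
      CurveClass.stopAt F (Ψ D₁ S) = CurveClass.stopAt F (Ψ D₂ S) := by
  have hδs : Tendsto δs atTop (𝓝[>] 0) :=
    tendsto_nhdsWithin_iff.2 ⟨hlim, Eventually.of_forall hpos⟩
  -- the closed sets `K m`
  have hK : ∀ m : ℕ, IsClosed (closure {p : CurveClass ℂ × CurveClass ℂ |
      ∃ (c c' : Curve ℂ) (s : unitInterval), CurveClass.mk c = p.1 ∧ CurveClass.mk c' = p.2 ∧
        (∀ t : unitInterval, t ≤ s → c t = c' t) ∧
        c s ∈ Metric.cthickening (1 / ((m : ℝ) + 1)) F} ∪ Set.diagonal (CurveClass ℂ)) :=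
    fun m => isClosed_closure.union isClosed_diagonal
  have hmem : ∀ m : ℕ, ∀ᵐ S ∂(μ : Measure (QuadConfig (Set.univ : Set ℂ))),
      (Ψ D₁ S, Ψ D₂ S) ∈ closure {p : CurveClass ℂ × CurveClass ℂ |
        ∃ (c c' : Curve ℂ) (s : unitInterval), CurveClass.mk c = p.1 ∧ CurveClass.mk c' = p.2 ∧
          (∀ t : unitInterval, t ≤ s → c t = c' t) ∧
          c s ∈ Metric.cthickening (1 / ((m : ℝ) + 1)) F} ∪ Set.diagonal (CurveClass ℂ) := by
    intro m
    refine ae_mem_of_joint_of_isClosed (P := bondPercolation (zdGraph 2) half)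
      (fun n => measurable_z2QuadConfig isOpen_univ (hpos n))
      (fun n => measurable_bondInterfaceIn_of_family D₁ hE₁ (hpos n))
      (fun n => measurable_bondInterfaceIn_of_family D₂ hE₂ (hpos n)) hΨ₁ hΨ₂ h3₁ h3₂ (hK m) ?_
    filter_upwards [hδs.eventually (hlat _ (by positivity : (0 : ℝ) < 1 / ((m : ℝ) + 1)))]
      with n hn ω
    rcases hn ω with heq | ⟨c, c', s, hc, hc', hagree, hend⟩
    · exact Or.inr (Set.mem_diagonal_iff.2 heq)
    · exact Or.inl (subset_closure ⟨c, c', s, hc, hc', hagree, hend⟩)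
  filter_upwards [ae_all_iff.2 hmem] with S hS
  by_cases heq : Ψ D₁ S = Ψ D₂ S
  · rw [heq]
  have hcl : ∀ m : ℕ, (Ψ D₁ S, Ψ D₂ S) ∈ closure {p : CurveClass ℂ × CurveClass ℂ |
      ∃ (c c' : Curve ℂ) (s : unitInterval), CurveClass.mk c = p.1 ∧ CurveClass.mk c' = p.2 ∧
        (∀ t : unitInterval, t ≤ s → c t = c' t) ∧
        c s ∈ Metric.cthickening (1 / ((m : ℝ) + 1)) F} := by
    intro m
    rcases hS m with h | h
    · exact h
    · exact absurd (Set.mem_diagonal_iff.1 h) heq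
  have hnear : ∀ m : ℕ, ∃ p ∈ {p : CurveClass ℂ × CurveClass ℂ |
      ∃ (c c' : Curve ℂ) (s : unitInterval), CurveClass.mk c = p.1 ∧ CurveClass.mk c' = p.2 ∧
        (∀ t : unitInterval, t ≤ s → c t = c' t) ∧
        c s ∈ Metric.cthickening (1 / ((m : ℝ) + 1)) F},
      dist (Ψ D₁ S, Ψ D₂ S) p < 1 / ((m : ℝ) + 1) := fun m =>
    Metric.mem_closure_iff.1 (hcl m) _ (by positivity)
  choose p hp hdist using hnear
  choose c c' s hc hc' hagree hend using hp
  have hrate : Tendsto (fun m : ℕ => dist (Ψ D₁ S, Ψ D₂ S) (p m)) atTop (𝓝 0) :=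
    squeeze_zero (fun _ => dist_nonneg) (fun m => (hdist m).le)
      tendsto_one_div_add_atTop_nhds_zero_nat
  have hY : Tendsto (fun m => CurveClass.mk (c m)) atTop (𝓝 (Ψ D₁ S)) := by
    rw [tendsto_iff_dist_tendsto_zero]
    refine squeeze_zero (fun _ => dist_nonneg) (fun m => ?_) hrate
    rw [hc m, dist_comm, Prod.dist_eq]
    exact le_max_left _ _
  have hZ : Tendsto (fun m => CurveClass.mk (c' m)) atTop (𝓝 (Ψ D₂ S)) := by
    rw [tendsto_iff_dist_tendsto_zero]
    refine squeeze_zero (fun _ => dist_nonneg) (fun m => ?_) hrate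
    rw [hc' m, dist_comm, Prod.dist_eq]
    exact le_max_right _ _
  exact stopAt_eq_of_commonPrefix hF c c' s (fun m : ℕ => 1 / ((m : ℝ) + 1)) hY hZ
    hagree hend tendsto_one_div_add_atTop_nhds_zero_nat

/-! ### The two locality conjuncts of `stub_freeAxioms` from exact lattice identities -/

/-- **`IsLocal` of the hand-off family from the lattice locality identity.** -/
theorem isLocal_of_handsOff
    (Ψ : DobrushinDomain → QuadConfig (Set.univ : Set ℂ) → CurveClass ℂ)
    (h1 : ∀ D : DobrushinDomain, Measurable (Ψ D))
    (h3 : ∀ (μ : FiniteMeasure (QuadConfig (Set.univ : Set ℂ))) (δs : ℕ → ℝ), (∀ n, 0 < δs n) →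
      Tendsto δs atTop (𝓝 0) →
      Tendsto (fun n => z2QuadLaw (Set.univ : Set ℂ) (δs n)) atTop (𝓝 μ) →
      ∀ (D : DobrushinDomain) (E : ℝ → DiscreteDobrushin), ZdDiscretisationFamily D E →
        ∀ f : (QuadConfig (Set.univ : Set ℂ) × CurveClass ℂ) →ᵇ ℝ,
          Tendsto (fun n => ∫ ω, f (z2QuadConfig (Set.univ : Set ℂ) (δs n) ω,
              bondInterfaceIn D (E (δs n)) ω) ∂(bondPercolation (zdGraph 2) half))
            atTop (𝓝 (∫ S, f (S, Ψ D S) ∂(μ : Measure (QuadConfig (Set.univ : Set ℂ))))))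
    (hdisc : ∀ D D' : DobrushinDomain, D'.carrier ⊆ D.carrier → D'.pt 0 = D.pt 0 →
      D'.pt 1 = D.pt 1 → ∃ E E' : ℝ → DiscreteDobrushin,
        ZdDiscretisationFamily D E ∧ ZdDiscretisationFamily D' E' ∧
        ∀ ρ : ℝ, 0 < ρ → ∀ᶠ δ in 𝓝[>] (0 : ℝ), ∀ ω : BondConfig (Site 2),
          bondInterfaceIn D' (E' δ) ω = bondInterfaceIn D (E δ) ω ∨
          ∃ (c c' : Curve ℂ) (s : unitInterval), CurveClass.mk c = bondInterfaceIn D' (E' δ) ω ∧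
            CurveClass.mk c' = bondInterfaceIn D (E δ) ω ∧
            (∀ t : unitInterval, t ≤ s → c t = c' t) ∧
            c s ∈ Metric.cthickening ρ (closure (D.carrier \ D'.carrier)))
    {μ : FiniteMeasure (QuadConfig (Set.univ : Set ℂ))}
    (hμ : μ ∈ subseqQuadLimits (Set.univ : Set ℂ)) :
    ChordalFamily.IsLocal (fun D => (μ : Measure (QuadConfig (Set.univ : Set ℂ))).map (Ψ D)) := by
  intro D D' hsub h0 h1m T hT
  obtain ⟨E, E', hE, hE', hlat⟩ := hdisc D D' hsub h0 h1m
  obtain ⟨δs, hpos, hlim, hconv⟩ := (isSubseqQuadLimit_iff Set.univ μ).1 hμ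
  have hF : IsClosed (closure (D.carrier \ D'.carrier)) := isClosed_closure
  have hae := ae_stopAt_eq_of_handsOff_pair hpos hlim hE' hE (h1 D') (h1 D)
    (h3 μ δs hpos hlim hconv D' E' hE') (h3 μ δs hpos hlim hconv D E hE) hF hlat
  have hmeas : MeasurableSet (CurveClass.stopAt (closure (D.carrier \ D'.carrier)) ⁻¹' T) :=
    measurableSet_preimage_stopAt hF hT
  show ((μ : Measure (QuadConfig (Set.univ : Set ℂ))).map (Ψ D')) _ =
    ((μ : Measure (QuadConfig (Set.univ : Set ℂ))).map (Ψ D)) _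
  rw [Measure.map_apply (h1 D') hmeas, Measure.map_apply (h1 D) hmeas]
  refine measure_congr ?_
  filter_upwards [hae] with S hS
  show (S ∈ Ψ D' ⁻¹' (CurveClass.stopAt (closure (D.carrier \ D'.carrier)) ⁻¹' T)) =
    (S ∈ Ψ D ⁻¹' (CurveClass.stopAt (closure (D.carrier \ D'.carrier)) ⁻¹' T))
  simp only [Set.mem_preimage, hS]

/-- **`IsTargetIndependent` of the hand-off family from the lattice splitting identity.** -/
theorem isTargetIndependent_of_handsOff
    (Ψ : DobrushinDomain → QuadConfig (Set.univ : Set ℂ) → CurveClass ℂ)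
    (h1 : ∀ D : DobrushinDomain, Measurable (Ψ D))
    (h3 : ∀ (μ : FiniteMeasure (QuadConfig (Set.univ : Set ℂ))) (δs : ℕ → ℝ), (∀ n, 0 < δs n) →
      Tendsto δs atTop (𝓝 0) →
      Tendsto (fun n => z2QuadLaw (Set.univ : Set ℂ) (δs n)) atTop (𝓝 μ) →
      ∀ (D : DobrushinDomain) (E : ℝ → DiscreteDobrushin), ZdDiscretisationFamily D E →
        ∀ f : (QuadConfig (Set.univ : Set ℂ) × CurveClass ℂ) →ᵇ ℝ,
          Tendsto (fun n => ∫ ω, f (z2QuadConfig (Set.univ : Set ℂ) (δs n) ω,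
              bondInterfaceIn D (E (δs n)) ω) ∂(bondPercolation (zdGraph 2) half))
            atTop (𝓝 (∫ S, f (S, Ψ D S) ∂(μ : Measure (QuadConfig (Set.univ : Set ℂ))))))
    (hdiscT : ∀ D : MarkedDomain 3, ∃ E₁ E₂ : ℝ → DiscreteDobrushin,
      ZdDiscretisationFamily (D.chord 0 1 (by decide)) E₁ ∧
      ZdDiscretisationFamily (D.chord 0 2 (by decide)) E₂ ∧
      ∀ ρ : ℝ, 0 < ρ → ∀ᶠ δ in 𝓝[>] (0 : ℝ), ∀ ω : BondConfig (Site 2),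
        bondInterfaceIn (D.chord 0 1 (by decide)) (E₁ δ) ω =
          bondInterfaceIn (D.chord 0 2 (by decide)) (E₂ δ) ω ∨
        ∃ (c c' : Curve ℂ) (s : unitInterval),
          CurveClass.mk c = bondInterfaceIn (D.chord 0 1 (by decide)) (E₁ δ) ω ∧
          CurveClass.mk c' = bondInterfaceIn (D.chord 0 2 (by decide)) (E₂ δ) ω ∧
          (∀ t : unitInterval, t ≤ s → c t = c' t) ∧ c s ∈ Metric.cthickening ρ (D.arc 1))
    {μ : FiniteMeasure (QuadConfig (Set.univ : Set ℂ))}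
    (hμ : μ ∈ subseqQuadLimits (Set.univ : Set ℂ)) :
    ChordalFamily.IsTargetIndependent
      (fun D => (μ : Measure (QuadConfig (Set.univ : Set ℂ))).map (Ψ D)) := by
  intro D T hT
  obtain ⟨E₁, E₂, hE₁, hE₂, hlat⟩ := hdiscT D
  obtain ⟨δs, hpos, hlim, hconv⟩ := (isSubseqQuadLimit_iff Set.univ μ).1 hμ
  have hF : IsClosed (D.arc 1) := D.isClosed_arc 1
  have hae := ae_stopAt_eq_of_handsOff_pair hpos hlim hE₁ hE₂ (h1 _) (h1 _)
    (h3 μ δs hpos hlim hconv _ E₁ hE₁) (h3 μ δs hpos hlim hconv _ E₂ hE₂) hF hlat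
  have hmeas : MeasurableSet (CurveClass.stopAt (D.arc 1) ⁻¹' T) :=
    measurableSet_preimage_stopAt hF hT
  show ((μ : Measure (QuadConfig (Set.univ : Set ℂ))).map (Ψ (D.chord 0 1 (by decide)))) _ =
    ((μ : Measure (QuadConfig (Set.univ : Set ℂ))).map (Ψ (D.chord 0 2 (by decide)))) _
  rw [Measure.map_apply (h1 _) hmeas, Measure.map_apply (h1 _) hmeas]
  refine measure_congr ?_
  filter_upwards [hae] with S hS
  show (S ∈ Ψ (D.chord 0 1 (by decide)) ⁻¹' (CurveClass.stopAt (D.arc 1) ⁻¹' T)) =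
    (S ∈ Ψ (D.chord 0 2 (by decide)) ⁻¹' (CurveClass.stopAt (D.arc 1) ⁻¹' T))
  simp only [Set.mem_preimage, hS]

/-! ### The registered sub-stub -/

/-- **Registered sub-stub `stub_freeAxioms_localityPassage`.**  For a Borel reading `Ψ` with the
joint hand-off property (`h1`, `h3` of `stub_freeAxioms`), the exact lattice locality identity for
nested Dobrushin domains and the exact lattice splitting identity for re-targeted domains (each
with its compatible admissible discretisation families) imply that for every subsequential
quad-crossing limit `μ` the family `P D := (Ψ D)_* μ` is LOCAL (LSW restriction form) and TARGET
INDEPENDENT. -/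
theorem stub_freeAxioms_localityPassage : ∀ Ψ : DobrushinDomain → QuadConfig (Set.univ : Set ℂ) → CurveClass ℂ, (∀ D : DobrushinDomain, Measurable (Ψ D)) → (∀ (μ : FiniteMeasure (QuadConfig (Set.univ : Set ℂ))) (δs : ℕ → ℝ), (∀ n, 0 < δs n) → Tendsto δs atTop (𝓝 0) → Tendsto (fun n => z2QuadLaw (Set.univ : Set ℂ) (δs n)) atTop (𝓝 μ) → ∀ (D : DobrushinDomain) (E : ℝ → DiscreteDobrushin), ZdDiscretisationFamily D E → ∀ f : (QuadConfig (Set.univ : Set ℂ) × CurveClass ℂ) →ᵇ ℝ, Tendsto (fun n => ∫ ω, f (z2QuadConfig (Set.univ : Set ℂ) (δs n) ω, bondInterfaceIn D (E (δs n)) ω) ∂(bondPercolation (zdGraph 2) half)) atTop (𝓝 (∫ S, f (S, Ψ D S) ∂(μ : Measure (QuadConfig (Set.univ : Set ℂ)))))) → (∀ D D' : DobrushinDomain, D'.carrier ⊆ D.carrier → D'.pt 0 = D.pt 0 → D'.pt 1 = D.pt 1 → ∃ E E' : ℝ → DiscreteDobrushin, ZdDiscretisationFamily D E ∧ ZdDiscretisationFamily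 D' E' ∧ ∀ ρ : ℝ, 0 < ρ → ∀ᶠ δ in nhdsWithin (0 : ℝ) (Set.Ioi 0), ∀ ω : BondConfig (Site 2), bondInterfaceIn D' (E' δ) ω = bondInterfaceIn D (E δ) ω ∨ ∃ (c c' : Curve ℂ) (s : unitInterval), CurveClass.mk c = bondInterfaceIn D' (E' δ) ω ∧ CurveClass.mk c' = bondInterfaceIn D (E δ) ω ∧ (∀ t : unitInterval, t ≤ s → c t = c' t) ∧ c s ∈ Metric.cthickening ρ (closure (D.carrier \ D'.carrier))) → (∀ D : MarkedDomain 3, ∃ E₁ E₂ : ℝ → DiscreteDobrushin, ZdDiscretisationFamily (D.chord 0 1 (by decide)) E₁ ∧ ZdDiscretisationFamily (D.chord 0 2 (by decide)) E₂ ∧ ∀ ρ : ℝ, 0 < ρ → ∀ᶠ δ in nhdsWithin (0 : ℝ) (Set.Ioi 0), ∀ ω : BondConfig (Site 2), bondInterfaceIn (D.chord 0 1 (by decide)) (E₁ δ) ω = bondInterfaceIn (D.chord 0 2 (by decide)) (E₂ δ) ω ∨ ∃ (c c' : Curve ℂ) (s : unitInterval), CurveClass.mk c = bondInterfaceIn (D.chord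 0 1 (by decide)) (E₁ δ) ω ∧ CurveClass.mk c' = bondInterfaceIn (D.chord 0 2 (by decide)) (E₂ δ) ω ∧ (∀ t : unitInterval, t ≤ s → c t = c' t) ∧ c s ∈ Metric.cthickening ρ (D.arc 1)) → ∀ μ ∈ subseqQuadLimits (Set.univ : Set ℂ), ChordalFamily.IsLocal (fun D => (μ : Measure (QuadConfig (Set.univ : Set ℂ))).map (Ψ D)) ∧ ChordalFamily.IsTargetIndependent (fun D => (μ : Measure (QuadConfig (Set.univ : Set ℂ))).map (Ψ D)) :=
  fun Ψ h1 h3 hdisc hdiscT _ hμ =>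
    ⟨isLocal_of_handsOff Ψ h1 h3 hdisc hμ, isTargetIndependent_of_handsOff Ψ h1 h3 hdiscT hμ⟩

end Summit.CriticalPhenomena.CardyFormulaZ2.Cruxes.LagHandOff.CrosscutDictionary

end
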